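import Mathlib
import Summits.NavierStokesRegularity.FluidComputer.AbcClassIIGraphBound

/-!
# Class-II X0 chain with the COORDINATE EIGENVECTOR EXPORTED: Galerkin section eigenpairs ⇒ a rapidly
# decaying class-II coordinate eigenvector (instab3 g8, cell `ns-blowup`, 2026-08-27)

HONEST FRAMING (human ruling D-0035): nothing here is a claim about Navier–Stokes blow-up.
WHAT THIS IS NOT: not NS evidence. MODEL lane (forced-ABC linearisation, class II, coordinates of
`AbcClassIIDefs`); no certificate, number or census word moves.

instab4 g6's `AbcClassIIX0.isLinNSEigenvalue_of_section_eigenpairs` and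
`AbcClassIIGraphBound.isLinNSEigenvalue_of_section_eigenpairs'` conclude `Torus.IsLinNSEigenvalue` and
FORGET the class-II coordinate eigenvector their proofs construct. For the INERTIA-3L «exactly one»
sentence (`AbcInertiaDictionary.eq_of_coordinate_leader`) that vector is the needed input. This file is the
same two theorems with the coordinate conclusion EXPORTED (proofs = instab4's, verbatim up to the last
step): `coordinates_of_section_eigenpairs` (explicit graph bound) and `coordinates_of_section_eigenpairs'`
(graph bound derived): section eigenpairs of `[−(|O|²/R)δ + amat]` on `cubeIdx (K₀+n)` with eigenvalues in
`[x₁, x₂]`, `Σ v² = 1` ⇒ `∃ λ ∈ [x₁, x₂]`, `∃ wc : Idx → ℂ`, `wc ≠ 0`, rapidly decaying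
(`∀ s, Σ(1+|O|²)^s|wc|² < ∞`), with `−(|O_i|²/R) wc_i + Σ_{j ∈ nbrIdx i} amat i j wc_j = λ wc_i`.

Mathlib + `AbcClassIIGraphBound` (transitively `AbcClassIIX0`); no new definitions; std axioms. [folklore]
-/

noncomputable section

open scoped BigOperators ComplexConjugate InnerProductSpace
open Finset MeasureTheory UnitAddTorus Filter Topology

namespace Summit.NavierStokesRegularity.FluidComputer.AbcClassII

open Literature.Analysis.FunctionSpaces Literature.Analysis.FunctionSpaces.Torus
open Literature.Analysis.FunctionSpaces.EuclideanSpace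
open Literature.Analysis.FluidPDE Literature.Analysis.FluidPDE.SteadyLattice
open Literature.Analysis.FluidPDE.ScalarFourier

/-- **Section eigenpairs ⇒ a rapidly decaying coordinate eigenvector** (explicit graph bound; instab4's
`isLinNSEigenvalue_of_section_eigenpairs` with the coordinates exported). -/
theorem coordinates_of_section_eigenpairs {R : ℝ} (hR : 1 ≤ R) (K₀ : ℕ) {x₁ x₂ : ℝ}
    (v : ℕ → Idx → ℝ) (xs : ℕ → ℝ) (hxs : ∀ n, xs n ∈ Set.Icc x₁ x₂)
    (heig : ∀ n, ∀ i ∈ cubeIdx (K₀ + n),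
      -(onormSq i.1 / R) * v n i + ∑ j ∈ cubeIdx (K₀ + n), amat i j * v n j = xs n * v n i)
    (hnorm : ∀ n, ∑ j ∈ cubeIdx (K₀ + n), v n j ^ 2 = 1) {C : ℝ} (hC : 0 ≤ C)
    (hgraph : ∀ n, ∑ j ∈ cubeIdx (K₀ + n), (1 + onormSq j.1 / R) ^ 2 * v n j ^ 2 ≤ C ^ 2) :
    ∃ lam ∈ Set.Icc x₁ x₂, ∃ wc : Idx → ℂ, wc ≠ 0 ∧
      (∀ s : ℕ, Summable fun i : Idx => (1 + onormSq i.1) ^ s * ‖wc i‖ ^ 2) ∧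
      ∀ i : Idx, ((-(onormSq i.1 / R) : ℝ) : ℂ) * wc i + ∑ j ∈ nbrIdx i, ((amat i j : ℝ) : ℂ) * wc j =
        (lam : ℂ) * wc i := by
  classical
  have hR0 : 0 < R := by linarith
  -- the Hilbert space ℓ²(Idx) with its canonical basis
  let b : HilbertBasis Idx ℂ (lp (fun _ : Idx => ℂ) 2) := ⟨LinearIsometryEquiv.refl ℂ _⟩
  have hb : ∀ (z : lp (fun _ : Idx => ℂ) 2) (i : Idx), ⟪b i, z⟫_ℂ = z i := fun z i => by
    rw [← b.repr_apply_apply]; rfl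
  -- levels
  set ℓ : Idx → ℝ := fun i => -(onormSq i.1 / R) with hℓ
  have hℓ0 : ∀ i, ℓ i ≤ 0 := fun i => neg_nonpos.mpr (div_nonneg (onormSq_nonneg _) hR0.le)
  have hℓt : Tendsto ℓ cofinite atBot := tendsto_levels hR0
  -- constants and the base point
  set Kc : ℝ := 2592 * Real.sqrt R with hKc
  have hKc0 : 0 ≤ Kc := by positivity
  set P : ℝ := ((288 * 288 : ℕ) : ℝ) * Kc with hP
  have hP0 : 0 ≤ P := by positivity
  set x₀ : ℝ := P ^ 2 + 2 with hx₀
  have hx₀1 : 1 ≤ x₀ := by nlinarith [sq_nonneg P]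
  have hx₀0 : 0 < x₀ := by linarith
  -- the resolvent symbol and the weights
  obtain ⟨d, hdform, hd, hd0, hw0, hwℓ, -⟩ :=
    SkewCutGalerkinWeights.exists_resolventSymbol (𝕜 := ℂ) ℓ hℓ0 hℓt x₀ hx₀1
  have hwgt : ∀ i, Real.sqrt (1 + |ℓ i|) = Real.sqrt (1 + onormSq i.1 / R) := fun i => by
    simp only [hℓ]; rw [abs_neg, abs_of_nonneg (div_nonneg (onormSq_nonneg _) hR0.le)]
  -- the matrix of the relative bound
  set t : Idx → Idx → ℂ := fun i j => ((amat i j : ℝ) : ℂ) * d j with ht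
  have htx : ∀ i j, t i j * ((x₀ : ℂ) - (ℓ j : ℂ)) = ((amat i j : ℝ) : ℂ) := fun i j => by
    have h := hd j
    change ((amat i j : ℝ) : ℂ) * d j * ((x₀ : ℂ) - (ℓ j : ℂ)) = ((amat i j : ℝ) : ℂ)
    linear_combination ((amat i j : ℝ) : ℂ) * h
  have ht0 : ∀ i j, j ∉ nbrIdx i → t i j = 0 := fun i j hj => by
    change ((amat i j : ℝ) : ℂ) * d j = 0
    rw [amat_eq_zero_of_not_mem hj]; simp
  -- first-order growth
  have hgrow : ∀ j : Idx, 2592 * Real.sqrt (1 + onormSq j.1) ≤ Kc * Real.sqrt (1 + onormSq j.1 / R) := by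
    intro j
    rw [hKc, mul_assoc, ← Real.sqrt_mul hR0.le]
    refine mul_le_mul_of_nonneg_left (Real.sqrt_le_sqrt ?_) (by norm_num)
    rw [mul_add, mul_one, mul_div_cancel₀ _ hR0.ne']
    linarith [onormSq_nonneg j.1]
  have ha : ∀ i j, j ∈ nbrIdx i → ‖t i j * ((x₀ : ℂ) - (ℓ j : ℂ))‖ ≤ Kc * Real.sqrt (1 + |ℓ j|) := by
    intro i j _
    rw [htx, Complex.norm_real, Real.norm_eq_abs, hwgt]
    exact (abs_amat_le i j).trans (hgrow j)
  -- comparable weights along the band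
  have hL : ∀ i j, j ∈ nbrIdx i → Real.sqrt (1 + |ℓ i|) ≤ Real.sqrt (2 * (1 + R⁻¹)) * Real.sqrt (1 + |ℓ j|) := by
    intro i j hj
    rw [hwgt, hwgt, ← Real.sqrt_mul (by positivity)]
    exact Real.sqrt_le_sqrt (one_add_onormSq_le_of_mem_nbrIdx hR0 hj)
  -- the resolvent gains what the weight costs
  have hM : ∀ i, ‖d i‖ * Real.sqrt (1 + |ℓ i|) ≤ 1 / Real.sqrt x₀ := by
    intro i
    have e : ‖d i‖ = (x₀ - ℓ i)⁻¹ := by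
      rw [hdform i, RCLike.norm_ofReal, abs_of_nonneg (inv_nonneg.mpr (by linarith [hℓ0 i]))]
    rw [e]; exact SkewCutGalerkinLattice.weight_mul_symbol_le (hℓ0 i) hx₀1
  -- Schur data
  have hsymm : ∀ i j : Idx, j ∈ nbrIdx i ↔ i ∈ nbrIdx j := mem_nbrIdx_comm
  have hWcard : ∀ i : Idx, (nbrIdx i).card ≤ 288 * 288 := card_nbrIdx_le
  have hq : ((288 * 288 : ℕ) : ℝ) * Kc * (1 / Real.sqrt x₀) < 1 := by
    rw [← hP, mul_one_div, div_lt_one (Real.sqrt_pos.mpr hx₀0), Real.lt_sqrt hP0, hx₀]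
    linarith
  obtain ⟨hrow, hRle, hcol, hCle, hR00, hprod⟩ :=
    SkewCutGalerkinLattice.schur_data_of_band t ℓ x₀ (fun i => d i) hd nbrIdx hsymm hWcard ht0
      (fun i => Real.sqrt (1 + |ℓ i|)) hKc0 (by positivity) ha hM hq
  -- the sections and their eigenpairs
  set F : ℕ → Finset Idx := fun n => cubeIdx (K₀ + n) with hFdef
  have hF : Monotone F := fun m n h => cubeIdx_mono (Nat.add_le_add_left h K₀)
  have hFex : ∀ i, ∃ n, i ∈ F n := fun i => ⟨osupNorm i.1, mem_cubeIdx.mpr (Nat.le_add_left _ _)⟩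
  set c : ℕ → Idx → ℂ := fun n i => ((v n i : ℝ) : ℂ) with hcdef
  have heig' : ∀ n, ∀ i ∈ F n, (ℓ i : ℂ) * c n i +
      ∑ j ∈ F n, (t i j * ((x₀ : ℂ) - (ℓ j : ℂ))) * c n j = (xs n : ℂ) * c n i := by
    intro n i hi
    simp_rw [htx]
    have h := congrArg (fun r : ℝ => (r : ℂ)) (heig n i hi)
    push_cast at h
    change (((-(onormSq i.1 / R)) : ℝ) : ℂ) * ((v n i : ℝ) : ℂ) +
      ∑ j ∈ cubeIdx (K₀ + n), ((amat i j : ℝ) : ℂ) * ((v n j : ℝ) : ℂ) = ((xs n : ℝ) : ℂ) * ((v n i : ℝ) : ℂ)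
    push_cast
    linear_combination h
  have hnorm' : ∀ n, ∑ j ∈ F n, ‖c n j‖ ^ 2 = 1 := by
    intro n
    change ∑ j ∈ cubeIdx (K₀ + n), ‖((v n j : ℝ) : ℂ)‖ ^ 2 = 1
    simp only [Complex.norm_real, Real.norm_eq_abs, sq_abs]
    exact hnorm n
  have hgraph' : ∀ n, ∑ j ∈ F n, ‖((x₀ : ℂ) - (ℓ j : ℂ)) * c n j‖ ^ 2 ≤ (x₀ * C) ^ 2 := by
    intro n
    have hterm : ∀ j : Idx, ‖((x₀ : ℂ) - (ℓ j : ℂ)) * c n j‖ ^ 2 ≤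
        x₀ ^ 2 * ((1 + onormSq j.1 / R) ^ 2 * v n j ^ 2) := by
      intro j
      have e : ‖((x₀ : ℂ) - (ℓ j : ℂ)) * c n j‖ = (x₀ + onormSq j.1 / R) * |v n j| := by
        change ‖((x₀ : ℂ) - (((-(onormSq j.1 / R)) : ℝ) : ℂ)) * ((v n j : ℝ) : ℂ)‖ = _
        rw [norm_mul, Complex.norm_real, Real.norm_eq_abs,
          show ((x₀ : ℂ) - (((-(onormSq j.1 / R)) : ℝ) : ℂ)) = ((x₀ + onormSq j.1 / R : ℝ) : ℂ) by push_cast; ring,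
          Complex.norm_real, Real.norm_eq_abs, abs_of_nonneg (by linarith [div_nonneg (onormSq_nonneg j.1) hR0.le])]
      rw [e, mul_pow, sq_abs]
      have hκ : 0 ≤ onormSq j.1 / R := div_nonneg (onormSq_nonneg j.1) hR0.le
      have h1 : x₀ + onormSq j.1 / R ≤ x₀ * (1 + onormSq j.1 / R) := by nlinarith
      have h2 : (x₀ + onormSq j.1 / R) ^ 2 ≤ (x₀ * (1 + onormSq j.1 / R)) ^ 2 :=
        pow_le_pow_left₀ (by linarith) h1 2
      nlinarith [sq_nonneg (v n j)]
    calc ∑ j ∈ F n, ‖((x₀ : ℂ) - (ℓ j : ℂ)) * c n j‖ ^ 2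
        ≤ ∑ j ∈ F n, x₀ ^ 2 * ((1 + onormSq j.1 / R) ^ 2 * v n j ^ 2) := Finset.sum_le_sum fun j _ => hterm j
      _ = x₀ ^ 2 * ∑ j ∈ F n, (1 + onormSq j.1 / R) ^ 2 * v n j ^ 2 := by rw [Finset.mul_sum]
      _ ≤ x₀ ^ 2 * C ^ 2 := mul_le_mul_of_nonneg_left (hgraph n) (sq_nonneg _)
      _ = (x₀ * C) ^ 2 := by ring
  -- the abstract chain (closed bracket)
  obtain ⟨T, -, -, lam, hlam, w, hw1, hcoordw, hreg⟩ :=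
    SkewCutGalerkinFromSectionsIcc.exists_smooth_eigenvector_Icc_of_sections b ℓ x₀ d hd hd0 t hrow hRle
      hcol hCle hR00 hR00 hprod nbrIdx hsymm hWcard ht0 (fun i => Real.sqrt (1 + |ℓ i|)) hw0 hwℓ hKc0 ha
      (by positivity) hL hM F hF hFex c xs hxs heig' hnorm' (by positivity) hgraph'
  -- the coordinates
  set wc : Idx → ℂ := fun i => ⟪b i, w⟫_ℂ with hwc
  have hcoord : ∀ i : Idx, ((-(onormSq i.1 / R) : ℝ) : ℂ) * wc i +
      ∑ j ∈ nbrIdx i, ((amat i j : ℝ) : ℂ) * wc j = (lam : ℂ) * wc i := by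
    intro i
    have hs : ∑ j ∈ nbrIdx i, (t i j * ((x₀ : ℂ) - (ℓ j : ℂ))) * wc j =
        ∑ j ∈ nbrIdx i, ((amat i j : ℝ) : ℂ) * wc j :=
      Finset.sum_congr rfl fun j _ => by rw [htx]
    rw [← hs]
    exact hcoordw i
  -- weighted summability of the coordinates
  have hwsum : ∀ s : ℕ, Summable fun i : Idx => (1 + onormSq i.1) ^ s * ‖wc i‖ ^ 2 := by
    intro s
    refine Summable.of_nonneg_of_le (fun i => mul_nonneg (pow_nonneg (by linarith [onormSq_nonneg i.1]) _)
      (sq_nonneg _)) (fun i => ?_) ((hreg s).mul_left (R ^ s))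
    have h1 : 1 + onormSq i.1 ≤ R * Real.sqrt (1 + |ℓ i|) ^ 2 := by
      rw [hwgt, Real.sq_sqrt (by linarith [div_nonneg (onormSq_nonneg i.1) hR0.le]), mul_add, mul_one,
        mul_div_cancel₀ _ hR0.ne']
      linarith [onormSq_nonneg i.1]
    have h2 : (1 + onormSq i.1) ^ s ≤ (R * Real.sqrt (1 + |ℓ i|) ^ 2) ^ s :=
      pow_le_pow_left₀ (by linarith [onormSq_nonneg i.1]) h1 s
    calc (1 + onormSq i.1) ^ s * ‖wc i‖ ^ 2 ≤ (R * Real.sqrt (1 + |ℓ i|) ^ 2) ^ s * ‖wc i‖ ^ 2 :=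
          mul_le_mul_of_nonneg_right h2 (sq_nonneg _)
      _ = R ^ s * (Real.sqrt (1 + |ℓ i|) ^ (2 * s) * ‖⟪b i, w⟫_ℂ‖ ^ 2) := by
          rw [mul_pow, ← pow_mul]; ring
  -- the coordinate vector is non-zero
  have hw0 : w ≠ 0 := by
    intro h; rw [h, norm_zero] at hw1; exact zero_ne_one hw1
  have hwc0 : wc ≠ 0 := by
    intro hall
    apply hw0
    apply lp.ext
    funext i
    have := congrFun hall i
    rw [hwc] at this
    simp only [hb] at this
    simpa using this
  exact ⟨lam, hlam, wc, hwc0, hwsum, hcoord⟩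

/-- **Section eigenpairs ⇒ a rapidly decaying coordinate eigenvector** (graph bound derived from the energy
bound; instab4's `isLinNSEigenvalue_of_section_eigenpairs'` with the coordinates exported). -/
theorem coordinates_of_section_eigenpairs' {R : ℝ} (hR : 1 ≤ R) (K₀ : ℕ) {x₁ x₂ : ℝ}
    (v : ℕ → Idx → ℝ) (xs : ℕ → ℝ) (hxs : ∀ n, xs n ∈ Set.Icc x₁ x₂)
    (heig : ∀ n, ∀ i ∈ cubeIdx (K₀ + n),
      -(onormSq i.1 / R) * v n i + ∑ j ∈ cubeIdx (K₀ + n), amat i j * v n j = xs n * v n i)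
    (hnorm : ∀ n, ∑ j ∈ cubeIdx (K₀ + n), v n j ^ 2 = 1) :
    ∃ lam ∈ Set.Icc x₁ x₂, ∃ wc : Idx → ℂ, wc ≠ 0 ∧
      (∀ s : ℕ, Summable fun i : Idx => (1 + onormSq i.1) ^ s * ‖wc i‖ ^ 2) ∧
      ∀ i : Idx, ((-(onormSq i.1 / R) : ℝ) : ℂ) * wc i + ∑ j ∈ nbrIdx i, ((amat i j : ℝ) : ℂ) * wc j =
        (lam : ℂ) * wc i := by
  set B : ℝ := 2 * (1 + |x₁| + |x₂|) ^ 2 + 5832 * (1 + R * (Real.sqrt 2 + |x₁| + |x₂|)) with hB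
  have hB0 : 0 ≤ B := by positivity
  refine coordinates_of_section_eigenpairs hR K₀ v xs hxs heig hnorm (C := Real.sqrt B) (Real.sqrt_nonneg _)
    fun n => ?_
  rw [Real.sq_sqrt hB0]
  refine (graph_bound_section hR (K₀ + n) (v n) (xs n) (heig n) (hnorm n)).trans ?_
  obtain ⟨h1, h2⟩ := hxs n
  have hx1 : (1 - xs n) ^ 2 ≤ (1 + |x₁| + |x₂|) ^ 2 := by
    have : |1 - xs n| ≤ 1 + |x₁| + |x₂| := by
      rcases le_or_gt 0 (1 - xs n) with h | h
      · rw [abs_of_nonneg h]; linarith [neg_le_abs x₁, abs_nonneg x₂]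
      · rw [abs_of_neg h]; linarith [le_abs_self x₂, abs_nonneg x₁]
    nlinarith [abs_nonneg (1 - xs n), sq_abs (1 - xs n)]
  have hx2 : Real.sqrt 2 - xs n ≤ Real.sqrt 2 + |x₁| + |x₂| := by linarith [neg_le_abs x₁, abs_nonneg x₂]
  have hR0 : 0 ≤ R := by linarith
  nlinarith [mul_le_mul_of_nonneg_left hx2 hR0]

end Summit.NavierStokesRegularity.FluidComputer.AbcClassII

end
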